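import Literature.NumberTheory.Rogawski1990.CMCharIdentityClauses
import Literature.NumberTheory.Rogawski1990.LocalTransferFundamentalLemma
import HarnessLib

/-!
# The character identities [Rogawski1990, 13.1.4 ∕ 4.13.1 (b)] ON TEST FUNCTIONS — the `C_c^∞` twins of ★ `LocalAPacket.CharIdentity(At)` and of the CM letters
# `CMNonsplit∕SplitCharIdentityAt`, `CMPacketCharIdentities`, `CMCharIdentityClauses`, `CMCharIdentityPackage`

Topic `NumberTheory/Rogawski1990`; namespace `Literature.NumberTheory.Rogawski1990`.  DEFINITIONS WITH BODY (`Prop`-valued predicates on GIVEN data) + their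
`Iff.rfl` unfoldings, read-backs and the «OLD ⇒ NEW» comparison lemmas; no named fact (net debt 0), no instance, no notation, no attribute, no `sorry`.  This
file ASSERTS NOTHING.  Cell `pub/hodgecm-mathlib`, crux H413 = `stmt-HodgeConjecture-24833`; REPAIR R1∕R2 of F0P3b-plan (g11)'s finding `FINDING-QCM-JUNK`
(2026-09-01, kernel-checked obstruction `Cruxes/H413/Lines/F0_P3b_QCMJunkObstruction.lean`), adopted by LEAD F0P3a-plan (g9) WORD T8-21 (A); pen A-p19 (g21).

WHY.  Print quantifies the identities over TEST FUNCTIONS: [Rogawski1990, §4.1 p. 40] «for `f ∈ C(G, ω)`» (★ `IsLocSmooth`: locally constant, compactly supported,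
§1.6 p. 6), Lemma 4.13.1 (b) p. 63 «`f → f^H`, … for all `f ∈ C_c^∞(G)`», Prop. 13.1.4 p. 199 «the relation `χ_ξ(f^H) = Σ ⟨ξ, π⟩χ_π(f)` holds».  ★
`LocalAPacket.CharIdentity P tr trξ Match := ∀ fH f, Match fH f → trξ fH = P.traceSum tr f` quantifies over ALL bare functions; read with `tr := IrrClass.smoothTrace μ`
(junk `0` off the Schwartz–Bruhat functions) and `Match := IsLocalDeltaTransfer …` (which sees only `G`-regular orbital integrals, blind to the value at `1`), the
identity FORCES every matched trace to vanish (`charIdentityAt_forces_zero` of the obstruction file) — a print-false premise under which the closer's `stub_K9STF` would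
close vacuously.  The repair is to carry the two test classes as PARAMETERS of the relation (`CharIdentityOn … TestH TestG`) and to instantiate them, at the CM places,
by ★ `IsLocSmooth` — the class of ★ `IsLocalDeltaTransferExists … IsLocSmooth IsLocSmooth` (N6's `LocalTransferExplicit`), so the transfers of record feed the
identity with no glue.  OLD ⇒ NEW is trivial (`CharIdentity.charIdentityOn`, `….test`); the old declarations stay untouched as negative edges.

THIS MODULE = the DEFINITIONS and their `Iff.rfl` unfoldings (statement lane); every lemma ABOUT them (OLD ⇒ NEW, read-backs, accessors) is in the sibling
theorems-only module `CharIdentityOnTestFunctionsLemmas.lean` (kernel lane).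
* §1 (generic, any class type `C`) **`LocalAPacket.CharIdentityOn P tr trξ Match TestH TestG`** + `charIdentityOn_iff`.
* §2 (CM-local, `G′_v = U(H′)(L⁺_v)`) **`LocalAPacket.CharIdentityAtTest L H′ v P tr ξ μH Δ mH mG`** := `CharIdentityOn` at `charDist ξ μH`, `IsLocalDeltaTransfer …`, `IsLocSmooth`,
  `IsLocSmooth` + `charIdentityAtTest_iff`.
* §3 **`CMNonsplitCharIdentityAtTest`**, **`CMSplitCharIdentityAtTest`**, **`CMPacketCharIdentitiesTest`** (+ `_iff`) and the read-off **`CMNonsplitCharIdentityAtTest.πs`**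
  (`Exists.choose`, as ★ `CMNonsplitCharIdentityAt.πs`) — binders VERBATIM from ★ `CMLocalCharacterIdentities` (ED. 3), only `CharIdentityAt ↦ CharIdentityAtTest`.
* §4 **`CMCharIdentityClausesTest`**, **`CMCharIdentityPackageTest`** (the TYPE of the re-typed `hQ` binder of `stub_K9STF` ∕ `stub_QCMT`, R3) + `_iff` ×2 — ★ `CMCharIdentityClauses`
  with `CMNonsplitCharIdentityAt ↦ …Test`, `CMSplitCharIdentityAt ↦ …Test`, everything else byte-identical (so the consumer's slot
  `some (hQ.nonsplit ξ v hns T a ha h μZ π2 πn hK hn).πs` re-types by renaming only; accessors in the sibling module).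
HONEST SCOPE.  Definitions and one-line logic; HC_CM is proved only modulo the printed citations until rung 0 closes; this file proves no printed statement.

## References
* [Rogawski1990] J. D. Rogawski, *Automorphic Representations of Unitary Groups in Three Variables*, Ann. of Math. Studies 123 (1990): §1.6 p. 6 (`C(G, ω)`), §4.1 p. 40,
  §4.13 Lemma 4.13.1 (b) p. 63, §12.2 p. 174, §13.1 Prop. 13.1.3 (d) and Prop. 13.1.4 p. 199, §13.3 pp. 201–202, §14.4 p. 237.
-/

noncomputable section

open MeasureTheory NumberField IsDedekindDomain Topology
open scoped Matrix MatrixGroups ComplexOrder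

namespace Literature.NumberTheory.Rogawski1990

open Literature.NumberTheory.Automorphic Literature.NumberTheory.Automorphic.UnitaryGroup
open Literature.NumberTheory.Automorphic.UnitaryGroup.CotangentForms Literature.NumberTheory.GaloisRepresentations
open Literature.NumberTheory.Automorphic.Arthur2013.Leaves.TECR

/-! ## §1 The identity ON TEST CLASSES, generic in the class type -/

namespace LocalAPacket

variable {C : Type*}

/-- **The character identity `χ_ξ(f^H) = Σ_{π ∈ Π(ξ_v)} ⟨ξ, π⟩ χ_π(f)` AS A RELATION ON TEST FUNCTIONS**: for every `H`-side test function `f^H` (`TestH f^H`), every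
`G`-side test function `f` (`TestG f`) and every matching `Match f^H f`, `trξ(f^H) = χ_{πⁿ}(f) + χ_{πˢ}(f)`.  All five are PARAMETERS; print's classes are `C_c^∞`
[§4.1 p. 40, Lemma 4.13.1 (b)]. [cite: Rogawski1990, §13.1 Prop. 13.1.4 p. 199; §4.13 Lemma 4.13.1 (b) p. 63] -/
def CharIdentityOn {TG TH : Type*} (P : LocalAPacket C) (tr : C → TG → ℂ) (trξ : TH → ℂ) (Match : TH → TG → Prop)
    (TestH : TH → Prop) (TestG : TG → Prop) : Prop :=
  ∀ (fH : TH) (f : TG), TestH fH → TestG f → Match fH f → trξ fH = P.traceSum tr f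

/-- Unfolding of `CharIdentityOn`. [cite: Rogawski1990, §13.1 Prop. 13.1.4 p. 199] -/
theorem charIdentityOn_iff {TG TH : Type*} (P : LocalAPacket C) (tr : C → TG → ℂ) (trξ : TH → ℂ) (Match : TH → TG → Prop)
    (TestH : TH → Prop) (TestG : TG → Prop) :
    P.CharIdentityOn tr trξ Match TestH TestG ↔ ∀ (fH : TH) (f : TG), TestH fH → TestG f → Match fH f → trξ fH = P.traceSum tr f :=
  Iff.rfl

end LocalAPacket

/-! ## §2 The CM-local instance on test functions: `G′_v = U(H′)(L⁺_v)`, `H_v = U(Φ₂)(L⁺_v) × U(Φ₁)(L⁺_v)`, classes `C_c^∞` = ★ `IsLocSmooth` -/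

section CMAt

variable (L : Type) [Field L] [NumberField L] [IsCMField L] (H' : Matrix (Fin 3) (Fin 3) L)
  (v : HeightOneSpectrum (𝓞 ↥(maximalRealSubfield L)))

/-- **The character identity (13.1.4) at the finite place `v` ON TEST FUNCTIONS**: ★ `CharIdentityAt`'s data (`χ_ξ := charDist ξ μ_H`, matching ★
`IsLocalDeltaTransfer L H′ v Δ m_H m_G`, member characters `tr` a PARAMETER) with BOTH functions restricted to `C_c^∞` (★ `IsLocSmooth`: locally constant,
compactly supported — the class of ★ `IsLocalDeltaTransferExists … IsLocSmooth IsLocSmooth`). [cite: Rogawski1990, §13.1 Prop. 13.1.4 p. 199; §4.13 Lemma 4.13.1 (b) p. 63; §1.6 p. 6] -/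
def LocalAPacket.CharIdentityAtTest
    {_hm : MeasurableSpace ((UnitaryGroup.cmDatum L 2 (Matrix.of fun i j : Fin 2 => if i.val + j.val + 1 = 2 then (1 : L) else 0)).Local v ×
      (UnitaryGroup.cmDatum L 1 (Matrix.of fun i j : Fin 1 => if i.val + j.val + 1 = 1 then (1 : L) else 0)).Local v)}
    {_ha : ∀ a : ((UnitaryGroup.cmDatum L 2 (Matrix.of fun i j : Fin 2 => if i.val + j.val + 1 = 2 then (1 : L) else 0)).Local v ×
        (UnitaryGroup.cmDatum L 1 (Matrix.of fun i j : Fin 1 => if i.val + j.val + 1 = 1 then (1 : L) else 0)).Local v),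
      MeasurableSpace (((UnitaryGroup.cmDatum L 2 (Matrix.of fun i j : Fin 2 => if i.val + j.val + 1 = 2 then (1 : L) else 0)).Local v ×
        (UnitaryGroup.cmDatum L 1 (Matrix.of fun i j : Fin 1 => if i.val + j.val + 1 = 1 then (1 : L) else 0)).Local v) ⧸
        Subgroup.centralizer ({a} : Set ((UnitaryGroup.cmDatum L 2 (Matrix.of fun i j : Fin 2 => if i.val + j.val + 1 = 2 then (1 : L) else 0)).Local v ×
        (UnitaryGroup.cmDatum L 1 (Matrix.of fun i j : Fin 1 => if i.val + j.val + 1 = 1 then (1 : L) else 0)).Local v)))}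
    {_hγ : ∀ γ : (UnitaryGroup.cmDatum L 3 H').Local v,
      MeasurableSpace ((UnitaryGroup.cmDatum L 3 H').Local v ⧸ Subgroup.centralizer ({γ} : Set ((UnitaryGroup.cmDatum L 3 H').Local v)))}
    (P : CMLocalAPacket L H' v)
    (tr : IrrClass ((UnitaryGroup.cmDatum L 3 H').Local v) → ((UnitaryGroup.cmDatum L 3 H').Local v → ℂ) → ℂ)
    (ξ : (UnitaryGroup.cmDatum L 2 (Matrix.of fun i j : Fin 2 => if i.val + j.val + 1 = 2 then (1 : L) else 0)).Local v ×
        (UnitaryGroup.cmDatum L 1 (Matrix.of fun i j : Fin 1 => if i.val + j.val + 1 = 1 then (1 : L) else 0)).Local v →* ℂˣ)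
    (μH : Measure ((UnitaryGroup.cmDatum L 2 (Matrix.of fun i j : Fin 2 => if i.val + j.val + 1 = 2 then (1 : L) else 0)).Local v ×
        (UnitaryGroup.cmDatum L 1 (Matrix.of fun i j : Fin 1 => if i.val + j.val + 1 = 1 then (1 : L) else 0)).Local v))
    (T : LocalTransferFactor L H' v)
    (mH : OrbitalMeasureFamily ((UnitaryGroup.cmDatum L 2 (Matrix.of fun i j : Fin 2 => if i.val + j.val + 1 = 2 then (1 : L) else 0)).Local v ×
        (UnitaryGroup.cmDatum L 1 (Matrix.of fun i j : Fin 1 => if i.val + j.val + 1 = 1 then (1 : L) else 0)).Local v))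
    (mG : OrbitalMeasureFamily ((UnitaryGroup.cmDatum L 3 H').Local v)) : Prop :=
  P.CharIdentityOn tr (charDist ξ μH) (fun fH f => IsLocalDeltaTransfer L H' v T mH mG fH f) IsLocSmooth IsLocSmooth

/-- Unfolding of `CharIdentityAtTest`: for every `Δ`-matching pair `(f^H_v, f_v)` of TEST functions, `∫ ξ f^H_v dμ_H = χ_{πⁿ}(f_v) + χ_{πˢ}(f_v)`.
[cite: Rogawski1990, §13.1 Prop. 13.1.4 p. 199; §4.13 Lemma 4.13.1 (b) p. 63] -/
theorem LocalAPacket.charIdentityAtTest_iff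
    {_hm : MeasurableSpace ((UnitaryGroup.cmDatum L 2 (Matrix.of fun i j : Fin 2 => if i.val + j.val + 1 = 2 then (1 : L) else 0)).Local v ×
      (UnitaryGroup.cmDatum L 1 (Matrix.of fun i j : Fin 1 => if i.val + j.val + 1 = 1 then (1 : L) else 0)).Local v)}
    {_ha : ∀ a : ((UnitaryGroup.cmDatum L 2 (Matrix.of fun i j : Fin 2 => if i.val + j.val + 1 = 2 then (1 : L) else 0)).Local v ×
        (UnitaryGroup.cmDatum L 1 (Matrix.of fun i j : Fin 1 => if i.val + j.val + 1 = 1 then (1 : L) else 0)).Local v),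
      MeasurableSpace (((UnitaryGroup.cmDatum L 2 (Matrix.of fun i j : Fin 2 => if i.val + j.val + 1 = 2 then (1 : L) else 0)).Local v ×
        (UnitaryGroup.cmDatum L 1 (Matrix.of fun i j : Fin 1 => if i.val + j.val + 1 = 1 then (1 : L) else 0)).Local v) ⧸
        Subgroup.centralizer ({a} : Set ((UnitaryGroup.cmDatum L 2 (Matrix.of fun i j : Fin 2 => if i.val + j.val + 1 = 2 then (1 : L) else 0)).Local v ×
        (UnitaryGroup.cmDatum L 1 (Matrix.of fun i j : Fin 1 => if i.val + j.val + 1 = 1 then (1 : L) else 0)).Local v)))}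
    {_hγ : ∀ γ : (UnitaryGroup.cmDatum L 3 H').Local v,
      MeasurableSpace ((UnitaryGroup.cmDatum L 3 H').Local v ⧸ Subgroup.centralizer ({γ} : Set ((UnitaryGroup.cmDatum L 3 H').Local v)))}
    (P : CMLocalAPacket L H' v)
    (tr : IrrClass ((UnitaryGroup.cmDatum L 3 H').Local v) → ((UnitaryGroup.cmDatum L 3 H').Local v → ℂ) → ℂ)
    (ξ : (UnitaryGroup.cmDatum L 2 (Matrix.of fun i j : Fin 2 => if i.val + j.val + 1 = 2 then (1 : L) else 0)).Local v ×
        (UnitaryGroup.cmDatum L 1 (Matrix.of fun i j : Fin 1 => if i.val + j.val + 1 = 1 then (1 : L) else 0)).Local v →* ℂˣ)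
    (μH : Measure ((UnitaryGroup.cmDatum L 2 (Matrix.of fun i j : Fin 2 => if i.val + j.val + 1 = 2 then (1 : L) else 0)).Local v ×
        (UnitaryGroup.cmDatum L 1 (Matrix.of fun i j : Fin 1 => if i.val + j.val + 1 = 1 then (1 : L) else 0)).Local v))
    (T : LocalTransferFactor L H' v)
    (mH : OrbitalMeasureFamily ((UnitaryGroup.cmDatum L 2 (Matrix.of fun i j : Fin 2 => if i.val + j.val + 1 = 2 then (1 : L) else 0)).Local v ×
        (UnitaryGroup.cmDatum L 1 (Matrix.of fun i j : Fin 1 => if i.val + j.val + 1 = 1 then (1 : L) else 0)).Local v))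
    (mG : OrbitalMeasureFamily ((UnitaryGroup.cmDatum L 3 H').Local v)) :
    P.CharIdentityAtTest L H' v tr ξ μH T mH mG ↔
      ∀ fH f, IsLocSmooth fH → IsLocSmooth f → IsLocalDeltaTransfer L H' v T mH mG fH f → ∫ h, (ξ h : ℂ) * fH h ∂μH = P.traceSum tr f :=
  Iff.rfl

end CMAt

/-! ## §3 The CM letters [13.1.4] on given data, ON TEST FUNCTIONS: non-split, split, packet form; the read-off `πˢ` -/

section CM

variable (L : Type) [Field L] [NumberField L] [IsCMField L]
  (v : HeightOneSpectrum (𝓞 ↥(maximalRealSubfield L)))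

variable (H' : Matrix (Fin 3) (Fin 3) L)

variable
    [MeasurableSpace ((UnitaryGroup.cmDatum L 3 H').Local v)]
    [MeasurableSpace ((UnitaryGroup.cmDatum L 2 (Matrix.of fun i j : Fin 2 => if i.val + j.val + 1 = 2 then (1 : L) else 0)).Local v ×
      (UnitaryGroup.cmDatum L 1 (Matrix.of fun i j : Fin 1 => if i.val + j.val + 1 = 1 then (1 : L) else 0)).Local v)]
    [∀ a : ((UnitaryGroup.cmDatum L 2 (Matrix.of fun i j : Fin 2 => if i.val + j.val + 1 = 2 then (1 : L) else 0)).Local v ×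
        (UnitaryGroup.cmDatum L 1 (Matrix.of fun i j : Fin 1 => if i.val + j.val + 1 = 1 then (1 : L) else 0)).Local v),
      MeasurableSpace (((UnitaryGroup.cmDatum L 2 (Matrix.of fun i j : Fin 2 => if i.val + j.val + 1 = 2 then (1 : L) else 0)).Local v ×
        (UnitaryGroup.cmDatum L 1 (Matrix.of fun i j : Fin 1 => if i.val + j.val + 1 = 1 then (1 : L) else 0)).Local v) ⧸
        Subgroup.centralizer ({a} : Set ((UnitaryGroup.cmDatum L 2 (Matrix.of fun i j : Fin 2 => if i.val + j.val + 1 = 2 then (1 : L) else 0)).Local v ×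
        (UnitaryGroup.cmDatum L 1 (Matrix.of fun i j : Fin 1 => if i.val + j.val + 1 = 1 then (1 : L) else 0)).Local v)))]
    [∀ γ : (UnitaryGroup.cmDatum L 3 H').Local v,
      MeasurableSpace ((UnitaryGroup.cmDatum L 3 H').Local v ⧸ Subgroup.centralizer ({γ} : Set ((UnitaryGroup.cmDatum L 3 H').Local v)))]

/-- **[13.1.4] at a NON-SPLIT finite place, on given data, ON TEST FUNCTIONS** (the `C_c^∞` twin of ★ `CMNonsplitCharIdentityAt`, same binders and order): there is a
SUPERCUSPIDAL class `πˢ ≠ πⁿ` [13.1.3 (d)] with `Tr πⁿ(f_v dμ_G) + Tr πˢ(f_v dμ_G) = ∫ ξ_v f^H_v dμ_H` for every `Δ_v`-matching pair of TEST functions.  A PREDICATE.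
[cite: Rogawski1990, §13.1 Prop. 13.1.3 (d), Prop. 13.1.4 p. 199; §14.4 p. 237] -/
def CMNonsplitCharIdentityAtTest
    (T : LocalTransferFactor L H' v)
    (mH : OrbitalMeasureFamily ((UnitaryGroup.cmDatum L 2 (Matrix.of fun i j : Fin 2 => if i.val + j.val + 1 = 2 then (1 : L) else 0)).Local v ×
        (UnitaryGroup.cmDatum L 1 (Matrix.of fun i j : Fin 1 => if i.val + j.val + 1 = 1 then (1 : L) else 0)).Local v))
    (mG : OrbitalMeasureFamily ((UnitaryGroup.cmDatum L 3 H').Local v)) (μG : Measure ((UnitaryGroup.cmDatum L 3 H').Local v))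
    (μH : Measure ((UnitaryGroup.cmDatum L 2 (Matrix.of fun i j : Fin 2 => if i.val + j.val + 1 = 2 then (1 : L) else 0)).Local v ×
        (UnitaryGroup.cmDatum L 1 (Matrix.of fun i j : Fin 1 => if i.val + j.val + 1 = 1 then (1 : L) else 0)).Local v))
    (ξv : (UnitaryGroup.cmDatum L 2 (Matrix.of fun i j : Fin 2 => if i.val + j.val + 1 = 2 then (1 : L) else 0)).Local v ×
        (UnitaryGroup.cmDatum L 1 (Matrix.of fun i j : Fin 1 => if i.val + j.val + 1 = 1 then (1 : L) else 0)).Local v →* ℂˣ)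
    (πn : IrrClass ((UnitaryGroup.cmDatum L 3 H').Local v)) : Prop :=
  ∃ πs : IrrClass ((UnitaryGroup.cmDatum L 3 H').Local v), πs.IsSupercuspidal ∧ πs ≠ πn ∧
    (⟨πn, some πs⟩ : CMLocalAPacket L H' v).CharIdentityAtTest L H' v (fun c f => c.smoothTrace μG f) ξv μH T mH mG

/-- Unfolding of `CMNonsplitCharIdentityAtTest`, token for token. [cite: Rogawski1990, §13.1 Prop. 13.1.4 p. 199] -/
theorem cmNonsplitCharIdentityAtTest_iff
    (T : LocalTransferFactor L H' v)
    (mH : OrbitalMeasureFamily ((UnitaryGroup.cmDatum L 2 (Matrix.of fun i j : Fin 2 => if i.val + j.val + 1 = 2 then (1 : L) else 0)).Local v ×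
        (UnitaryGroup.cmDatum L 1 (Matrix.of fun i j : Fin 1 => if i.val + j.val + 1 = 1 then (1 : L) else 0)).Local v))
    (mG : OrbitalMeasureFamily ((UnitaryGroup.cmDatum L 3 H').Local v)) (μG : Measure ((UnitaryGroup.cmDatum L 3 H').Local v))
    (μH : Measure ((UnitaryGroup.cmDatum L 2 (Matrix.of fun i j : Fin 2 => if i.val + j.val + 1 = 2 then (1 : L) else 0)).Local v ×
        (UnitaryGroup.cmDatum L 1 (Matrix.of fun i j : Fin 1 => if i.val + j.val + 1 = 1 then (1 : L) else 0)).Local v))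
    (ξv : (UnitaryGroup.cmDatum L 2 (Matrix.of fun i j : Fin 2 => if i.val + j.val + 1 = 2 then (1 : L) else 0)).Local v ×
        (UnitaryGroup.cmDatum L 1 (Matrix.of fun i j : Fin 1 => if i.val + j.val + 1 = 1 then (1 : L) else 0)).Local v →* ℂˣ)
    (πn : IrrClass ((UnitaryGroup.cmDatum L 3 H').Local v)) :
    CMNonsplitCharIdentityAtTest L v H' T mH mG μG μH ξv πn ↔
      ∃ πs : IrrClass ((UnitaryGroup.cmDatum L 3 H').Local v), πs.IsSupercuspidal ∧ πs ≠ πn ∧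
        (⟨πn, some πs⟩ : CMLocalAPacket L H' v).CharIdentityAtTest L H' v (fun c f => c.smoothTrace μG f) ξv μH T mH mG :=
  Iff.rfl

variable (hH' : (H'.map (cmConjRingHom L))ᵀ = H') (hH'd : IsUnit H'.det)

/-- **[13.1.4] at a SPLIT finite place, on given data, ON TEST FUNCTIONS** (the `C_c^∞` twin of ★ `CMSplitCharIdentityAt`, same binders and order): the singleton packet
★ `cmSplitPacket` satisfies `Tr i_G(ξ_w)(f_v dμ_G) = ∫ ξ_v f^H_v dμ_H` for every `Δ_v`-matching pair of TEST functions [Lemma 4.13.1 (b): «for all `f ∈ C_c^∞(G)`»].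
A PREDICATE. [cite: Rogawski1990, §13.1 Prop. 13.1.4 p. 199; §4.13 Lemma 4.13.1 (b) p. 63; §13.3 p. 201] -/
def CMSplitCharIdentityAtTest
    (w : UnitaryGroup.PlacesOver L v) (hw : IsCMField.complexConj L • w.1 ≠ w.1)
    [LocallyCompactSpace (standardParabolicGL (w.1.adicCompletion L) (Zelevinsky1980.lastBlockLabel 3))]
    (ν₀ χ' : (w.1.adicCompletion L)ˣ →* ℂˣ) (hν₀u : ∀ x, ‖((ν₀ x : ℂˣ) : ℂ)‖ = 1)
    (hν₀c : Continuous fun x => ((ν₀ x : ℂˣ) : ℂ)) (hχ'u : ∀ x, ‖((χ' x : ℂˣ) : ℂ)‖ = 1)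
    (hχ'c : Continuous fun x => ((χ' x : ℂˣ) : ℂ))
    (T : LocalTransferFactor L H' v)
    (mH : OrbitalMeasureFamily ((UnitaryGroup.cmDatum L 2 (Matrix.of fun i j : Fin 2 => if i.val + j.val + 1 = 2 then (1 : L) else 0)).Local v ×
        (UnitaryGroup.cmDatum L 1 (Matrix.of fun i j : Fin 1 => if i.val + j.val + 1 = 1 then (1 : L) else 0)).Local v))
    (mG : OrbitalMeasureFamily ((UnitaryGroup.cmDatum L 3 H').Local v)) (μG : Measure ((UnitaryGroup.cmDatum L 3 H').Local v))
    (μH : Measure ((UnitaryGroup.cmDatum L 2 (Matrix.of fun i j : Fin 2 => if i.val + j.val + 1 = 2 then (1 : L) else 0)).Local v ×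
        (UnitaryGroup.cmDatum L 1 (Matrix.of fun i j : Fin 1 => if i.val + j.val + 1 = 1 then (1 : L) else 0)).Local v))
    (ξv : (UnitaryGroup.cmDatum L 2 (Matrix.of fun i j : Fin 2 => if i.val + j.val + 1 = 2 then (1 : L) else 0)).Local v ×
        (UnitaryGroup.cmDatum L 1 (Matrix.of fun i j : Fin 1 => if i.val + j.val + 1 = 1 then (1 : L) else 0)).Local v →* ℂˣ) : Prop :=
  (cmSplitPacket L H' hH' hH'd v w hw ν₀ χ' hν₀u hν₀c hχ'u hχ'c).CharIdentityAtTest L H' v (fun c f => c.smoothTrace μG f) ξv μH T mH mG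

/-- Unfolding of `CMSplitCharIdentityAtTest`, token for token. [cite: Rogawski1990, §13.1 Prop. 13.1.4 p. 199; §13.3 p. 201] -/
theorem cmSplitCharIdentityAtTest_iff
    (w : UnitaryGroup.PlacesOver L v) (hw : IsCMField.complexConj L • w.1 ≠ w.1)
    [LocallyCompactSpace (standardParabolicGL (w.1.adicCompletion L) (Zelevinsky1980.lastBlockLabel 3))]
    (ν₀ χ' : (w.1.adicCompletion L)ˣ →* ℂˣ) (hν₀u : ∀ x, ‖((ν₀ x : ℂˣ) : ℂ)‖ = 1)
    (hν₀c : Continuous fun x => ((ν₀ x : ℂˣ) : ℂ)) (hχ'u : ∀ x, ‖((χ' x : ℂˣ) : ℂ)‖ = 1)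
    (hχ'c : Continuous fun x => ((χ' x : ℂˣ) : ℂ))
    (T : LocalTransferFactor L H' v)
    (mH : OrbitalMeasureFamily ((UnitaryGroup.cmDatum L 2 (Matrix.of fun i j : Fin 2 => if i.val + j.val + 1 = 2 then (1 : L) else 0)).Local v ×
        (UnitaryGroup.cmDatum L 1 (Matrix.of fun i j : Fin 1 => if i.val + j.val + 1 = 1 then (1 : L) else 0)).Local v))
    (mG : OrbitalMeasureFamily ((UnitaryGroup.cmDatum L 3 H').Local v)) (μG : Measure ((UnitaryGroup.cmDatum L 3 H').Local v))
    (μH : Measure ((UnitaryGroup.cmDatum L 2 (Matrix.of fun i j : Fin 2 => if i.val + j.val + 1 = 2 then (1 : L) else 0)).Local v ×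
        (UnitaryGroup.cmDatum L 1 (Matrix.of fun i j : Fin 1 => if i.val + j.val + 1 = 1 then (1 : L) else 0)).Local v))
    (ξv : (UnitaryGroup.cmDatum L 2 (Matrix.of fun i j : Fin 2 => if i.val + j.val + 1 = 2 then (1 : L) else 0)).Local v ×
        (UnitaryGroup.cmDatum L 1 (Matrix.of fun i j : Fin 1 => if i.val + j.val + 1 = 1 then (1 : L) else 0)).Local v →* ℂˣ) :
    CMSplitCharIdentityAtTest L v H' hH' hH'd w hw ν₀ χ' hν₀u hν₀c hχ'u hχ'c T mH mG μG μH ξv ↔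
      (cmSplitPacket L H' hH' hH'd v w hw ν₀ χ' hν₀u hν₀c hχ'u hχ'c).CharIdentityAtTest L H' v (fun c f => c.smoothTrace μG f) ξv μH T mH mG :=
  Iff.rfl

end CM

/-! ### §3b The read-off `πˢ(ξ_v)` of the non-split identity on test functions -/

section ReadOff

variable {L : Type} [Field L] [NumberField L] [IsCMField L] {v : HeightOneSpectrum (𝓞 ↥(maximalRealSubfield L))}
  {H' : Matrix (Fin 3) (Fin 3) L}

variable
    [MeasurableSpace ((UnitaryGroup.cmDatum L 3 H').Local v)]
    [MeasurableSpace ((UnitaryGroup.cmDatum L 2 (Matrix.of fun i j : Fin 2 => if i.val + j.val + 1 = 2 then (1 : L) else 0)).Local v ×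
      (UnitaryGroup.cmDatum L 1 (Matrix.of fun i j : Fin 1 => if i.val + j.val + 1 = 1 then (1 : L) else 0)).Local v)]
    [∀ a : ((UnitaryGroup.cmDatum L 2 (Matrix.of fun i j : Fin 2 => if i.val + j.val + 1 = 2 then (1 : L) else 0)).Local v ×
        (UnitaryGroup.cmDatum L 1 (Matrix.of fun i j : Fin 1 => if i.val + j.val + 1 = 1 then (1 : L) else 0)).Local v),
      MeasurableSpace (((UnitaryGroup.cmDatum L 2 (Matrix.of fun i j : Fin 2 => if i.val + j.val + 1 = 2 then (1 : L) else 0)).Local v ×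
        (UnitaryGroup.cmDatum L 1 (Matrix.of fun i j : Fin 1 => if i.val + j.val + 1 = 1 then (1 : L) else 0)).Local v) ⧸
        Subgroup.centralizer ({a} : Set ((UnitaryGroup.cmDatum L 2 (Matrix.of fun i j : Fin 2 => if i.val + j.val + 1 = 2 then (1 : L) else 0)).Local v ×
        (UnitaryGroup.cmDatum L 1 (Matrix.of fun i j : Fin 1 => if i.val + j.val + 1 = 1 then (1 : L) else 0)).Local v)))]
    [∀ γ : (UnitaryGroup.cmDatum L 3 H').Local v,
      MeasurableSpace ((UnitaryGroup.cmDatum L 3 H').Local v ⧸ Subgroup.centralizer ({γ} : Set ((UnitaryGroup.cmDatum L 3 H').Local v)))]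
    {T : LocalTransferFactor L H' v}
    {mH : OrbitalMeasureFamily ((UnitaryGroup.cmDatum L 2 (Matrix.of fun i j : Fin 2 => if i.val + j.val + 1 = 2 then (1 : L) else 0)).Local v ×
        (UnitaryGroup.cmDatum L 1 (Matrix.of fun i j : Fin 1 => if i.val + j.val + 1 = 1 then (1 : L) else 0)).Local v)}
    {mG : OrbitalMeasureFamily ((UnitaryGroup.cmDatum L 3 H').Local v)} {μG : Measure ((UnitaryGroup.cmDatum L 3 H').Local v)}
    {μH : Measure ((UnitaryGroup.cmDatum L 2 (Matrix.of fun i j : Fin 2 => if i.val + j.val + 1 = 2 then (1 : L) else 0)).Local v ×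
        (UnitaryGroup.cmDatum L 1 (Matrix.of fun i j : Fin 1 => if i.val + j.val + 1 = 1 then (1 : L) else 0)).Local v)}
    {ξv : (UnitaryGroup.cmDatum L 2 (Matrix.of fun i j : Fin 2 => if i.val + j.val + 1 = 2 then (1 : L) else 0)).Local v ×
        (UnitaryGroup.cmDatum L 1 (Matrix.of fun i j : Fin 1 => if i.val + j.val + 1 = 1 then (1 : L) else 0)).Local v →* ℂˣ}
    {πn : IrrClass ((UnitaryGroup.cmDatum L 3 H').Local v)}

/-- **`πˢ(ξ_v)` read off [13.1.4] on test functions** (a CHOICE of the existential, as ★ `CMNonsplitCharIdentityAt.πs`).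
[cite: Rogawski1990, §13.1 Prop. 13.1.3 (d), Prop. 13.1.4 p. 199] -/
def CMNonsplitCharIdentityAtTest.πs (h : CMNonsplitCharIdentityAtTest L v H' T mH mG μG μH ξv πn) :
    IrrClass ((UnitaryGroup.cmDatum L 3 H').Local v) :=
  Exists.choose h

end ReadOff

/-! ### §3c Packet form on test functions -/

section PacketForm

variable (L : Type) [Field L] [NumberField L] [IsCMField L] (H' : Matrix (Fin 3) (Fin 3) L)

variable
    [∀ v : HeightOneSpectrum (𝓞 ↥(maximalRealSubfield L)), MeasurableSpace ((UnitaryGroup.cmDatum L 3 H').Local v)]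
    [∀ v : HeightOneSpectrum (𝓞 ↥(maximalRealSubfield L)),
      MeasurableSpace ((UnitaryGroup.cmDatum L 2 (Matrix.of fun i j : Fin 2 => if i.val + j.val + 1 = 2 then (1 : L) else 0)).Local v ×
        (UnitaryGroup.cmDatum L 1 (Matrix.of fun i j : Fin 1 => if i.val + j.val + 1 = 1 then (1 : L) else 0)).Local v)]
    [∀ (v : HeightOneSpectrum (𝓞 ↥(maximalRealSubfield L)))
        (a : ((UnitaryGroup.cmDatum L 2 (Matrix.of fun i j : Fin 2 => if i.val + j.val + 1 = 2 then (1 : L) else 0)).Local v ×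
          (UnitaryGroup.cmDatum L 1 (Matrix.of fun i j : Fin 1 => if i.val + j.val + 1 = 1 then (1 : L) else 0)).Local v)),
      MeasurableSpace (((UnitaryGroup.cmDatum L 2 (Matrix.of fun i j : Fin 2 => if i.val + j.val + 1 = 2 then (1 : L) else 0)).Local v ×
          (UnitaryGroup.cmDatum L 1 (Matrix.of fun i j : Fin 1 => if i.val + j.val + 1 = 1 then (1 : L) else 0)).Local v) ⧸
        Subgroup.centralizer ({a} : Set ((UnitaryGroup.cmDatum L 2 (Matrix.of fun i j : Fin 2 => if i.val + j.val + 1 = 2 then (1 : L) else 0)).Local v ×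
          (UnitaryGroup.cmDatum L 1 (Matrix.of fun i j : Fin 1 => if i.val + j.val + 1 = 1 then (1 : L) else 0)).Local v)))]
    [∀ (v : HeightOneSpectrum (𝓞 ↥(maximalRealSubfield L))) (γ : (UnitaryGroup.cmDatum L 3 H').Local v),
      MeasurableSpace ((UnitaryGroup.cmDatum L 3 H').Local v ⧸ Subgroup.centralizer ({γ} : Set ((UnitaryGroup.cmDatum L 3 H').Local v)))]

/-- **[13.1.4] at a GIVEN FAMILY of finite local packets, on given data, ON TEST FUNCTIONS** (the `C_c^∞` twin of ★ `CMPacketCharIdentities`, same binders and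
order): at every finite `v`, `Σ_{π ∈ P_v} Tr π(f_v dμ_{G,v}) = ∫ ξ_v f^H_v dμ_{H,v}` for every `Δ_v`-matching pair of TEST functions.  A PREDICATE.
[cite: Rogawski1990, §13.1 Prop. 13.1.3 (d), Prop. 13.1.4 p. 199; §13.3 p. 201; §14.4 p. 237] -/
def CMPacketCharIdentitiesTest
    (Δ : ∀ v : HeightOneSpectrum (𝓞 ↥(maximalRealSubfield L)), LocalTransferFactor L H' v)
    (mH : ∀ v : HeightOneSpectrum (𝓞 ↥(maximalRealSubfield L)),
      OrbitalMeasureFamily ((UnitaryGroup.cmDatum L 2 (Matrix.of fun i j : Fin 2 => if i.val + j.val + 1 = 2 then (1 : L) else 0)).Local v ×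
        (UnitaryGroup.cmDatum L 1 (Matrix.of fun i j : Fin 1 => if i.val + j.val + 1 = 1 then (1 : L) else 0)).Local v))
    (mG : ∀ v : HeightOneSpectrum (𝓞 ↥(maximalRealSubfield L)), OrbitalMeasureFamily ((UnitaryGroup.cmDatum L 3 H').Local v))
    (μG : ∀ v : HeightOneSpectrum (𝓞 ↥(maximalRealSubfield L)), Measure ((UnitaryGroup.cmDatum L 3 H').Local v))
    (μH : ∀ v : HeightOneSpectrum (𝓞 ↥(maximalRealSubfield L)),
      Measure ((UnitaryGroup.cmDatum L 2 (Matrix.of fun i j : Fin 2 => if i.val + j.val + 1 = 2 then (1 : L) else 0)).Local v ×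
        (UnitaryGroup.cmDatum L 1 (Matrix.of fun i j : Fin 1 => if i.val + j.val + 1 = 1 then (1 : L) else 0)).Local v))
    (ξloc : ∀ v : HeightOneSpectrum (𝓞 ↥(maximalRealSubfield L)),
      (UnitaryGroup.cmDatum L 2 (Matrix.of fun i j : Fin 2 => if i.val + j.val + 1 = 2 then (1 : L) else 0)).Local v ×
        (UnitaryGroup.cmDatum L 1 (Matrix.of fun i j : Fin 1 => if i.val + j.val + 1 = 1 then (1 : L) else 0)).Local v →* ℂˣ)
    (P : ∀ v : HeightOneSpectrum (𝓞 ↥(maximalRealSubfield L)), CMLocalAPacket L H' v) : Prop :=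
  ∀ v : HeightOneSpectrum (𝓞 ↥(maximalRealSubfield L)),
    (P v).CharIdentityAtTest L H' v (fun c f => c.smoothTrace (μG v) f) (ξloc v) (μH v) (Δ v) (mH v) (mG v)

/-- Unfolding of `CMPacketCharIdentitiesTest`, token for token. [cite: Rogawski1990, §13.1 Prop. 13.1.4 p. 199] -/
theorem cmPacketCharIdentitiesTest_iff
    (Δ : ∀ v : HeightOneSpectrum (𝓞 ↥(maximalRealSubfield L)), LocalTransferFactor L H' v)
    (mH : ∀ v : HeightOneSpectrum (𝓞 ↥(maximalRealSubfield L)),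
      OrbitalMeasureFamily ((UnitaryGroup.cmDatum L 2 (Matrix.of fun i j : Fin 2 => if i.val + j.val + 1 = 2 then (1 : L) else 0)).Local v ×
        (UnitaryGroup.cmDatum L 1 (Matrix.of fun i j : Fin 1 => if i.val + j.val + 1 = 1 then (1 : L) else 0)).Local v))
    (mG : ∀ v : HeightOneSpectrum (𝓞 ↥(maximalRealSubfield L)), OrbitalMeasureFamily ((UnitaryGroup.cmDatum L 3 H').Local v))
    (μG : ∀ v : HeightOneSpectrum (𝓞 ↥(maximalRealSubfield L)), Measure ((UnitaryGroup.cmDatum L 3 H').Local v))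
    (μH : ∀ v : HeightOneSpectrum (𝓞 ↥(maximalRealSubfield L)),
      Measure ((UnitaryGroup.cmDatum L 2 (Matrix.of fun i j : Fin 2 => if i.val + j.val + 1 = 2 then (1 : L) else 0)).Local v ×
        (UnitaryGroup.cmDatum L 1 (Matrix.of fun i j : Fin 1 => if i.val + j.val + 1 = 1 then (1 : L) else 0)).Local v))
    (ξloc : ∀ v : HeightOneSpectrum (𝓞 ↥(maximalRealSubfield L)),
      (UnitaryGroup.cmDatum L 2 (Matrix.of fun i j : Fin 2 => if i.val + j.val + 1 = 2 then (1 : L) else 0)).Local v ×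
        (UnitaryGroup.cmDatum L 1 (Matrix.of fun i j : Fin 1 => if i.val + j.val + 1 = 1 then (1 : L) else 0)).Local v →* ℂˣ)
    (P : ∀ v : HeightOneSpectrum (𝓞 ↥(maximalRealSubfield L)), CMLocalAPacket L H' v) :
    CMPacketCharIdentitiesTest L H' Δ mH mG μG μH ξloc P ↔
      ∀ v : HeightOneSpectrum (𝓞 ↥(maximalRealSubfield L)),
        (P v).CharIdentityAtTest L H' v (fun c f => c.smoothTrace (μG v) f) (ξloc v) (μH v) (Δ v) (mH v) (mG v) :=
  Iff.rfl

end PacketForm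

/-! ## §4 The CM character-identity clauses and package of the joint letter, ON TEST FUNCTIONS (`Q_CM` re-typed: R2 ∕ R3 of the finding) -/

section Clauses

variable (L : Type) [Field L] [NumberField L] [IsCMField L] (H : Matrix (Fin 3) (Fin 3) L)
  (hH : (H.map (cmConjRingHom L))ᵀ = H) (hHd : IsUnit H.det)

variable
    [∀ v : HeightOneSpectrum (𝓞 ↥(maximalRealSubfield L)), MeasurableSpace ((cmDatum L 3 H).Local v)]
    [∀ v : HeightOneSpectrum (𝓞 ↥(maximalRealSubfield L)),
      MeasurableSpace ((cmDatum L 2 (Matrix.of fun i j : Fin 2 => if i.val + j.val + 1 = 2 then (1 : L) else 0)).Local v ×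
        (cmDatum L 1 (Matrix.of fun i j : Fin 1 => if i.val + j.val + 1 = 1 then (1 : L) else 0)).Local v)]
    [∀ (v : HeightOneSpectrum (𝓞 ↥(maximalRealSubfield L)))
        (a : ((cmDatum L 2 (Matrix.of fun i j : Fin 2 => if i.val + j.val + 1 = 2 then (1 : L) else 0)).Local v ×
          (cmDatum L 1 (Matrix.of fun i j : Fin 1 => if i.val + j.val + 1 = 1 then (1 : L) else 0)).Local v)),
      MeasurableSpace (((cmDatum L 2 (Matrix.of fun i j : Fin 2 => if i.val + j.val + 1 = 2 then (1 : L) else 0)).Local v ×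
          (cmDatum L 1 (Matrix.of fun i j : Fin 1 => if i.val + j.val + 1 = 1 then (1 : L) else 0)).Local v) ⧸
        Subgroup.centralizer ({a} : Set ((cmDatum L 2 (Matrix.of fun i j : Fin 2 => if i.val + j.val + 1 = 2 then (1 : L) else 0)).Local v ×
          (cmDatum L 1 (Matrix.of fun i j : Fin 1 => if i.val + j.val + 1 = 1 then (1 : L) else 0)).Local v)))]
    [∀ (v : HeightOneSpectrum (𝓞 ↥(maximalRealSubfield L))) (γ : (cmDatum L 3 H).Local v),
      MeasurableSpace ((cmDatum L 3 H).Local v ⧸ Subgroup.centralizer ({γ} : Set ((cmDatum L 3 H).Local v)))]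

/-- **The CM character-identity clauses of the joint letter, ON TEST FUNCTIONS** (the `C_c^∞` twin of ★ `CMCharIdentityClauses`: the non-split binder block
`v hns T a ha h μZ π2 πn hK hn` and the split instantiation at `splitWitness v hs`, `ξ.splitν₀ μω`, `ξ.locψ` BYTE-IDENTICAL; only `CMNonsplitCharIdentityAt ↦ …Test` and
`CMSplitCharIdentityAt ↦ …Test`). [cite: Rogawski1990, §13.1 Prop. 13.1.3 (d), Prop. 13.1.4 p. 199; §12.2 p. 174; §4.13 Lemma 4.13.1 (b) p. 63; §13.3 p. 201] -/
def CMCharIdentityClausesTest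
    (Δ : ∀ v : HeightOneSpectrum (𝓞 ↥(maximalRealSubfield L)), LocalTransferFactor L H v)
    (mH : ∀ v : HeightOneSpectrum (𝓞 ↥(maximalRealSubfield L)),
      OrbitalMeasureFamily ((cmDatum L 2 (Matrix.of fun i j : Fin 2 => if i.val + j.val + 1 = 2 then (1 : L) else 0)).Local v ×
        (cmDatum L 1 (Matrix.of fun i j : Fin 1 => if i.val + j.val + 1 = 1 then (1 : L) else 0)).Local v))
    (mG : ∀ v : HeightOneSpectrum (𝓞 ↥(maximalRealSubfield L)), OrbitalMeasureFamily ((cmDatum L 3 H).Local v))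
    (νH : ∀ v : HeightOneSpectrum (𝓞 ↥(maximalRealSubfield L)),
      Measure ((cmDatum L 2 (Matrix.of fun i j : Fin 2 => if i.val + j.val + 1 = 2 then (1 : L) else 0)).Local v ×
        (cmDatum L 1 (Matrix.of fun i j : Fin 1 => if i.val + j.val + 1 = 1 then (1 : L) else 0)).Local v))
    (νG : ∀ v : HeightOneSpectrum (𝓞 ↥(maximalRealSubfield L)), Measure ((cmDatum L 3 H).Local v))
    (ξ : OneDimAutRepH L) (μω : HeckeCharacter L) (hμu : μω.IsUnitary)
    (ξloc : ∀ v : HeightOneSpectrum (𝓞 ↥(maximalRealSubfield L)),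
      (cmDatum L 2 (Matrix.of fun i j : Fin 2 => if i.val + j.val + 1 = 2 then (1 : L) else 0)).Local v ×
        (cmDatum L 1 (Matrix.of fun i j : Fin 1 => if i.val + j.val + 1 = 1 then (1 : L) else 0)).Local v →* ℂˣ) : Prop :=
  (∀ (v : HeightOneSpectrum (𝓞 ↥(maximalRealSubfield L))),
      (∀ w : PlacesOver L v, IsCMField.complexConj L • w.1 = w.1) →
      ∀ (T : GL (Fin 3) (LocalRing L v)) (a : LocalRing L v) (ha : IsUnit a)
        (h : formCongr (conjLocal L (IsCMField.complexConj L) v) T (H.map (algebraMap L (LocalRing L v))) =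
          a • (Matrix.of fun i j : Fin 3 => if i.val + j.val + 1 = 3 then (1 : L) else 0).map (algebraMap L (LocalRing L v))),
      ∀ [MeasurableSpace (Gqs L v ⧸ Subgroup.center (Gqs L v))] [BorelSpace (Gqs L v ⧸ Subgroup.center (Gqs L v))]
        (μZ : Measure (Gqs L v ⧸ Subgroup.center (Gqs L v))) [μZ.IsHaarMeasure],
      ∀ (π2 πn : IrrClass (Gqs L v)),
        KeysCaseTwoLabels L v (μω.semilocalComponent L v) (torusLocalComponent L (IsCMField.complexConj L) v ξ.η)
          (torusLocalComponent L (IsCMField.complexConj L) v ξ.ψ) π2 πn →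
        ¬ πn.IsSquareIntegrable μZ →
        CMNonsplitCharIdentityAtTest L v H (Δ v) (mH v) (mG v) (νG v) (νH v) (ξloc v)
          (IrrClass.comap (cmDatumLocalCongr L v T ha h).symm πn)) ∧
  (∀ (v : HeightOneSpectrum (𝓞 ↥(maximalRealSubfield L))) (hs : ∃ w : PlacesOver L v, IsCMField.complexConj L • w.1 ≠ w.1),
      CMSplitCharIdentityAtTest L v H hH hHd (splitWitness v hs) (splitWitness_spec v hs) (ξ.splitν₀ μω (splitWitness v hs).1)
        (ξ.locψ (splitWitness v hs).1) (ξ.norm_splitν₀_apply hμu (splitWitness v hs).1)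
        (ξ.continuous_splitν₀ μω (splitWitness v hs).1) (ξ.norm_locψ_apply (splitWitness v hs).1)
        (ξ.continuous_locψ (splitWitness v hs).1) (Δ v) (mH v) (mG v) (νG v) (νH v) (ξloc v))

/-- **`Q_CM` ON TEST FUNCTIONS — the re-typed CM character-identity package** (the `C_c^∞` twin of ★ `CMCharIdentityPackage`; the TYPE of the `hQ` binder of the
closer's `stub_K9STF` ∕ `stub_QCMT` after repair R3): for the global data `(Δ_v, m_{H,v}, m_{G,v})_v`, the clauses `CMCharIdentityClausesTest` for EVERY global character
`ξ` of `H`, at the local characters `ξ_v = ξ.xiLocalChar v` BY NAME. [cite: Rogawski1990, §13.1 Prop. 13.1.4 p. 199; §4.13 Lemma 4.13.1 (b) p. 63; §13.3 p. 202] -/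
def CMCharIdentityPackageTest
    (νH : ∀ v : HeightOneSpectrum (𝓞 ↥(maximalRealSubfield L)),
      Measure ((cmDatum L 2 (Matrix.of fun i j : Fin 2 => if i.val + j.val + 1 = 2 then (1 : L) else 0)).Local v ×
        (cmDatum L 1 (Matrix.of fun i j : Fin 1 => if i.val + j.val + 1 = 1 then (1 : L) else 0)).Local v))
    (νG : ∀ v : HeightOneSpectrum (𝓞 ↥(maximalRealSubfield L)), Measure ((cmDatum L 3 H).Local v))
    (μω : HeckeCharacter L) (hμu : μω.IsUnitary) :
    (∀ v : HeightOneSpectrum (𝓞 ↥(maximalRealSubfield L)), LocalTransferFactor L H v) →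
    (∀ v : HeightOneSpectrum (𝓞 ↥(maximalRealSubfield L)),
      OrbitalMeasureFamily ((cmDatum L 2 (Matrix.of fun i j : Fin 2 => if i.val + j.val + 1 = 2 then (1 : L) else 0)).Local v ×
        (cmDatum L 1 (Matrix.of fun i j : Fin 1 => if i.val + j.val + 1 = 1 then (1 : L) else 0)).Local v)) →
    (∀ v : HeightOneSpectrum (𝓞 ↥(maximalRealSubfield L)), OrbitalMeasureFamily ((cmDatum L 3 H).Local v)) → Prop :=
  fun Δ mH mG => ∀ ξ : OneDimAutRepH L, CMCharIdentityClausesTest L H hH hHd Δ mH mG νH νG ξ μω hμu (fun v => ξ.xiLocalChar v)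

variable {L H hH hHd}
variable
  {Δ : ∀ v : HeightOneSpectrum (𝓞 ↥(maximalRealSubfield L)), LocalTransferFactor L H v}
  {mH : ∀ v : HeightOneSpectrum (𝓞 ↥(maximalRealSubfield L)),
    OrbitalMeasureFamily ((cmDatum L 2 (Matrix.of fun i j : Fin 2 => if i.val + j.val + 1 = 2 then (1 : L) else 0)).Local v ×
      (cmDatum L 1 (Matrix.of fun i j : Fin 1 => if i.val + j.val + 1 = 1 then (1 : L) else 0)).Local v)}
  {mG : ∀ v : HeightOneSpectrum (𝓞 ↥(maximalRealSubfield L)), OrbitalMeasureFamily ((cmDatum L 3 H).Local v)}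
  {νH : ∀ v : HeightOneSpectrum (𝓞 ↥(maximalRealSubfield L)),
    Measure ((cmDatum L 2 (Matrix.of fun i j : Fin 2 => if i.val + j.val + 1 = 2 then (1 : L) else 0)).Local v ×
      (cmDatum L 1 (Matrix.of fun i j : Fin 1 => if i.val + j.val + 1 = 1 then (1 : L) else 0)).Local v)}
  {νG : ∀ v : HeightOneSpectrum (𝓞 ↥(maximalRealSubfield L)), Measure ((cmDatum L 3 H).Local v)}
  {ξ : OneDimAutRepH L} {μω : HeckeCharacter L} {hμu : μω.IsUnitary}
  {ξloc : ∀ v : HeightOneSpectrum (𝓞 ↥(maximalRealSubfield L)),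
    (cmDatum L 2 (Matrix.of fun i j : Fin 2 => if i.val + j.val + 1 = 2 then (1 : L) else 0)).Local v ×
      (cmDatum L 1 (Matrix.of fun i j : Fin 1 => if i.val + j.val + 1 = 1 then (1 : L) else 0)).Local v →* ℂˣ}

/-- Unfolding of `CMCharIdentityClausesTest`, token for token. [cite: Rogawski1990, §13.1 Prop. 13.1.4 p. 199; §4.13 Lemma 4.13.1 (b) p. 63] -/
theorem cmCharIdentityClausesTest_iff :
    CMCharIdentityClausesTest L H hH hHd Δ mH mG νH νG ξ μω hμu ξloc ↔
      (∀ (v : HeightOneSpectrum (𝓞 ↥(maximalRealSubfield L))),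
          (∀ w : PlacesOver L v, IsCMField.complexConj L • w.1 = w.1) →
          ∀ (T : GL (Fin 3) (LocalRing L v)) (a : LocalRing L v) (ha : IsUnit a)
            (h : formCongr (conjLocal L (IsCMField.complexConj L) v) T (H.map (algebraMap L (LocalRing L v))) =
              a • (Matrix.of fun i j : Fin 3 => if i.val + j.val + 1 = 3 then (1 : L) else 0).map (algebraMap L (LocalRing L v))),
          ∀ [MeasurableSpace (Gqs L v ⧸ Subgroup.center (Gqs L v))] [BorelSpace (Gqs L v ⧸ Subgroup.center (Gqs L v))]
            (μZ : Measure (Gqs L v ⧸ Subgroup.center (Gqs L v))) [μZ.IsHaarMeasure],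
          ∀ (π2 πn : IrrClass (Gqs L v)),
            KeysCaseTwoLabels L v (μω.semilocalComponent L v) (torusLocalComponent L (IsCMField.complexConj L) v ξ.η)
              (torusLocalComponent L (IsCMField.complexConj L) v ξ.ψ) π2 πn →
            ¬ πn.IsSquareIntegrable μZ →
            CMNonsplitCharIdentityAtTest L v H (Δ v) (mH v) (mG v) (νG v) (νH v) (ξloc v)
              (IrrClass.comap (cmDatumLocalCongr L v T ha h).symm πn)) ∧
      (∀ (v : HeightOneSpectrum (𝓞 ↥(maximalRealSubfield L))) (hs : ∃ w : PlacesOver L v, IsCMField.complexConj L • w.1 ≠ w.1),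
          CMSplitCharIdentityAtTest L v H hH hHd (splitWitness v hs) (splitWitness_spec v hs) (ξ.splitν₀ μω (splitWitness v hs).1)
            (ξ.locψ (splitWitness v hs).1) (ξ.norm_splitν₀_apply hμu (splitWitness v hs).1)
            (ξ.continuous_splitν₀ μω (splitWitness v hs).1) (ξ.norm_locψ_apply (splitWitness v hs).1)
            (ξ.continuous_locψ (splitWitness v hs).1) (Δ v) (mH v) (mG v) (νG v) (νH v) (ξloc v)) :=
  Iff.rfl

/-- Unfolding of `CMCharIdentityPackageTest` (`Q_CM^{test} Δ m_H m_G ↔ ∀ ξ, CMCharIdentityClausesTest … ξ … (ξ.xiLocalChar ·)`).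
[cite: Rogawski1990, §13.1 Prop. 13.1.4 p. 199; §13.3 p. 202] -/
theorem cmCharIdentityPackageTest_iff :
    CMCharIdentityPackageTest L H hH hHd νH νG μω hμu Δ mH mG ↔
      ∀ ξ : OneDimAutRepH L, CMCharIdentityClausesTest L H hH hHd Δ mH mG νH νG ξ μω hμu (fun v => ξ.xiLocalChar v) :=
  Iff.rfl

end Clauses

end Literature.NumberTheory.Rogawski1990

end
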